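import Mathlib
import Summits.NavierStokesRegularity.NavierStokesRegularity.Theorems.AxisTwistDoorAveragedConeLiouvilleDefs
import Summits.NavierStokesRegularity.NavierStokesRegularity.Theorems.AxisTwistDoorAveragedConeLiouvilleZoomToSlackFree
import Summits.NavierStokesRegularity.NavierStokesRegularity.Theorems.AxisTwistDoorAveragedConeLiouvilleCircMonotone
import Summits.NavierStokesRegularity.NavierStokesRegularity.Theorems.AxisTwistDoorScalingToUnit
import Summits.NavierStokesRegularity.NavierStokesRegularity.Theorems.AxisTwistDoorAveragedConeLiouvilleFlatFlux
import Literature.Analysis.FluidPDE.VorticityCalculus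
import HarnessLib

/-!
# AxisTwistDoor · crux `AveragedConeLiouville` (stmt-NavierStokesRegularity-26889) · line `lrt_shell`, stub (6)
# `stub_regularOfFluxDecay : RegularOfFluxDecay` — by a SECOND ZOOM and the flat-flux rigidity

The printed route for stub (6) (Lei–Ren–Tian arXiv:2501.08976, p. 12: Biot–Savart with a cut-off at the regular
shell, ε-regularity) is replaced by an in-tree argument (ns-ezl-w3's census proposal «second zoom + rigidity»,
2026-08-28): if the apex of a class profile `v` with `ω₃ ≥ 0`, the slack-free circle cone and FLUX DECAY were
backward singular, zoom `v` into the apex INSIDE the class (stub (0)'s machinery `profileZoomFrame`,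
`profileZoom_curl_tendsto`): the limit `v₁` is a class profile, backward singular at `0` (persistence of
singularities), with `ω₃ ≥ 0` and the same cone (`inner_curl_nonneg_of_profileZoom`, `globalCone_of_profileZoom`),
and — this file — with VANISHING AXIS CIRCULATION `Γ_{v₁} ≡ 0`: by Stokes (`circ = ∫₀^R ∮ω₃`,
`…CircMonotone.circ_eq_integral_vortCirc`) on both sides, dominated convergence of `∮ω₃` on circles and then in the
radius (domination = the universal class gradient rate, scale invariant), and the scale covariance
`Γ_{λ•v(λ²·,λ·)}(R,z,s) = Γ_v(λR, λz, λ²s) → 0` (scale covariance, as in `…Rescale.circ_nsRescale`, + flux decay).  The flat-flux rigidity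
`…FlatFlux.not_backwardSingular_of_signE3_globalCone_circ_eq_zero` (ns-ezl-w3, landed) then says `v₁` is backward
REGULAR at `0` — contradiction.  No velocity convergence, no Biot–Savart, no ε-regularity, and none of the three
`Prop` antecedents (`StubCircleSwirl`, `CircleToolkit`, `ShellFact`) of the stub statement is used.

* `vortCirc_zoom_tendsto`, `abs_vortCirc_zoom_le`, `circ_zoom_tendsto`, `circ_zoom_tendsto_zero`,
  `circ_zoomLimit_eq_zero` — the limit passage for the circulation;
* `regularOfFluxDecay : RegularOfFluxDecay` — **the registered stub (6), BY NAME** (+ alias `stub_regularOfFluxDecay`).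

WHAT THIS IS NOT: not a statement about Navier–Stokes regularity; a step about HYPOTHETICAL Type-I blow-up profiles
(the crux `AveragedConeLiouville`, item 26991 and the leaf remain open).
[cite: LeiRenTian2025, §4 p. 11–12; AlbrittonBarker2019, §2–3; KochNadirashviliSereginSverak2009, §4–6]
-/

noncomputable section

-- the summit and its single sub-problem share the name (CONVENTIONS §1), as in every Theorems file
set_option linter.dupNamespace false

namespace Summit.NavierStokesRegularity.NavierStokesRegularity.Theorems.AveragedConeLiouvilleProfileZoom

open scoped Topology InnerProductSpace NNReal ENNReal
open Set Function MeasureTheory Filter Metric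
open Literature.Analysis
open Literature.Analysis.FluidPDE hiding eR
open Summit.NavierStokesRegularity.NavierStokesRegularity.Theorems
open Summit.NavierStokesRegularity.NavierStokesRegularity.Theorems.AxisTwistDoorAveragedConeLiouvilleDefs
open Summit.NavierStokesRegularity.NavierStokesRegularity.Theorems.AxisTwistDoorScalingToUnit (curl_nsRescale_apply nsRescale_slice)
open Summit.NavierStokesRegularity.NavierStokesRegularity.Theorems.AveragedConeLiouville.CircMonotone
  (continuous_vortCirc circ_eq_integral_vortCirc circ_nonneg)
open Summit.NavierStokesRegularity.NavierStokesRegularity.Theorems.LocalSineTubeDoorProfileAlignedWindowRigidityAncient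
  (analyticOnNhd_slice bdd_of_hasTypeITimeDecay)
open Summit.NavierStokesRegularity.NavierStokesRegularity.Theorems.PoloidalWindowDoorPoloidalWindowRigidityClassSpaceTimeRates
  (exists_fderiv_rate_of_class')

variable {C : ℝ} {v v₁ : ℝ → EuclideanSpace ℝ (Fin 3) → EuclideanSpace ℝ (Fin 3)} {lam : ℕ → ℝ} {Kd : ℝ}

/-! ### slices of class profiles and of their zooms are `C¹` -/

/-- Slices `v(t)`, `t < 0`, of a class profile are `C¹` (they are real-analytic). -/
theorem contDiff_one_slice (hrate : HasTypeITimeDecay C v)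
    (hcont : ContinuousOn (uncurry v) (Iio (0 : ℝ) ×ˢ univ))
    (hmild : ∀ s t : ℝ, s < t → t < 0 → ∀ x,
      v t x = UnboundedOperators.heatExtension (v s) (t - s) x - oseenDuhamel 1 s v v t x)
    {t : ℝ} (ht : t < 0) : ContDiff ℝ 1 (v t) :=
  (analyticOnNhd_slice hcont (bdd_of_hasTypeITimeDecay hrate) hmild ht).contDiff

/-- Slices of the zooms `nsRescale μ v`, `μ > 0`, at `s < 0` are `C¹` when the slices of `v` are. -/
theorem contDiff_one_nsRescale_slice (hv : ∀ t < 0, ContDiff ℝ 1 (v t)) {μ : ℝ} (hμ : 0 < μ) {s : ℝ} (hs : s < 0) :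
    ContDiff ℝ 1 (nsRescale μ v s) := by
  rw [nsRescale_slice]
  have hs' : μ ^ 2 * s < 0 := mul_neg_of_pos_of_neg (pow_pos hμ 2) hs
  exact ((hv _ hs').comp (contDiff_id.const_smul μ)).const_smul μ

/-! ### the limit passage for `∮ω₃` on a circle and for `Γ` -/

/-- **`∮_{S(ρ,z)} ω₃(zoom_j) dl → ∮_{S(ρ,z)} ω₃(v₁) dl`** for each circle: dominated convergence on `[0, 2π]`, the
integrands converging pointwise (zoomed vorticities converge) and being bounded by `‖curlCLM‖K_d ρ/(−s)` uniformly
in `j` (scale invariance of the class gradient rate). -/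
theorem vortCirc_zoom_tendsto (hlam : ∀ j, 0 < lam j)
    (hzoom : ∀ s < 0, ∀ y, Tendsto (fun j => (lam j) ^ 2 • curl (v ((lam j) ^ 2 * s)) ((lam j) • y)) atTop
      (𝓝 (curl (v₁ s) y)))
    (hcurl : ∀ t < 0, Continuous (curl (v t)))
    (hgrad : ∀ t < 0, ∀ y, ‖fderiv ℝ (v t) y‖ ≤ Kd / (-t))
    {s : ℝ} (hs : s < 0) (ρ z : ℝ) :
    Tendsto (fun j => vortCirc (nsRescale (lam j) v) ρ z s) atTop (𝓝 (vortCirc v₁ ρ z s)) := by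
  unfold vortCirc
  simp only [curl_nsRescale_apply]
  have hs' : ∀ j, (lam j) ^ 2 * s < 0 := fun j => mul_neg_of_pos_of_neg (pow_pos (hlam j) 2) hs
  have hcyl : Continuous fun θ : ℝ => cylPt ρ θ z := continuous_cylPoint ρ z
  have ha : ∀ j, Continuous fun θ : ℝ => (lam j) ^ 2 • curl (v ((lam j) ^ 2 * s)) ((lam j) • cylPt ρ θ z) := by
    intro j
    have h1 : Continuous fun θ : ℝ => curl (v ((lam j) ^ 2 * s)) ((lam j) • cylPt ρ θ z) :=
      (hcurl _ (hs' j)).comp (hcyl.const_smul (lam j))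
    exact h1.const_smul ((lam j) ^ 2)
  refine intervalIntegral.tendsto_integral_filter_of_dominated_convergence (fun _ => ‖curlCLM‖ * Kd / (-s) * |ρ|)
    (Eventually.of_forall fun j => (((ha j).inner continuous_const).mul continuous_const).aestronglyMeasurable)
    (Eventually.of_forall fun j => ae_of_all _ fun θ _ => ?_) intervalIntegrable_const
    (ae_of_all _ fun θ _ => ((hzoom s hs (cylPt ρ θ z)).inner tendsto_const_nhds).mul tendsto_const_nhds)
  rw [Real.norm_eq_abs, abs_mul]
  gcongr
  exact (abs_inner_e3_le _).trans (norm_zoomCurl_le hgrad hs (hlam j) _)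

/-- `|∮_{S(ρ,z)} ω₃(zoom_j) dl| ≤ 2π ‖curlCLM‖K_d |ρ|/(−s)`, uniformly in `j`. -/
theorem abs_vortCirc_zoom_le (hlam : ∀ j, 0 < lam j)
    (hgrad : ∀ t < 0, ∀ y, ‖fderiv ℝ (v t) y‖ ≤ Kd / (-t))
    {s : ℝ} (hs : s < 0) (ρ z : ℝ) (j : ℕ) :
    |vortCirc (nsRescale (lam j) v) ρ z s| ≤ ‖curlCLM‖ * Kd / (-s) * |ρ| * |2 * Real.pi - 0| := by
  unfold vortCirc
  simp only [curl_nsRescale_apply]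
  rw [← Real.norm_eq_abs]
  refine intervalIntegral.norm_integral_le_of_norm_le_const fun θ _ => ?_
  rw [Real.norm_eq_abs, abs_mul]
  gcongr
  exact (abs_inner_e3_le _).trans (norm_zoomCurl_le hgrad hs (hlam j) _)

/-- **`Γ_{zoom_j}(R,z,s) → Γ_{v₁}(R,z,s)`**: Stokes `Γ = ∫₀^R ∮ω₃` on both sides and dominated convergence in the
radius. -/
theorem circ_zoom_tendsto (hlam : ∀ j, 0 < lam j)
    (hzoom : ∀ s < 0, ∀ y, Tendsto (fun j => (lam j) ^ 2 • curl (v ((lam j) ^ 2 * s)) ((lam j) • y)) atTop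
      (𝓝 (curl (v₁ s) y)))
    (hv : ∀ t < 0, ContDiff ℝ 1 (v t)) (hv₁ : ∀ t < 0, ContDiff ℝ 1 (v₁ t))
    (hgrad : ∀ t < 0, ∀ y, ‖fderiv ℝ (v t) y‖ ≤ Kd / (-t))
    {s : ℝ} (hs : s < 0) (R z : ℝ) :
    Tendsto (fun j => circ (nsRescale (lam j) v) R z s) atTop (𝓝 (circ v₁ R z s)) := by
  have hcurl : ∀ t < 0, Continuous (curl (v t)) := fun t ht => continuous_curl (hv t ht)
  have hZ : ∀ j, ContDiff ℝ 1 (nsRescale (lam j) v s) := fun j => contDiff_one_nsRescale_slice hv (hlam j) hs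
  rw [circ_eq_integral_vortCirc v₁ (hv₁ s hs) z R]
  have hj : ∀ j, circ (nsRescale (lam j) v) R z s = ∫ ρ in (0 : ℝ)..R, vortCirc (nsRescale (lam j) v) ρ z s :=
    fun j => circ_eq_integral_vortCirc _ (hZ j) z R
  simp only [hj]
  -- the uniform bound on `Ι 0 R`
  set B : ℝ := ‖curlCLM‖ * Kd / (-s) * max |R| 1 * |2 * Real.pi - 0| with hB
  have hB0 : 0 ≤ ‖curlCLM‖ * Kd / (-s) :=
    (norm_nonneg _).trans (norm_zoomCurl_le hgrad hs (hlam 0) (0 : EuclideanSpace ℝ (Fin 3)))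
  refine intervalIntegral.tendsto_integral_filter_of_dominated_convergence (fun _ => B)
    (Eventually.of_forall fun j => (continuous_vortCirc _ (hZ j) z).aestronglyMeasurable)
    (Eventually.of_forall fun j => ae_of_all _ fun ρ hρ => ?_) intervalIntegrable_const
    (ae_of_all _ fun ρ _ => vortCirc_zoom_tendsto hlam hzoom hcurl hgrad hs ρ z)
  have hρR : |ρ| ≤ max |R| 1 := by
    rcases mem_uIoc.1 hρ with ⟨h1, h2⟩ | ⟨h1, h2⟩
    · exact (abs_le_abs_of_nonneg h1.le h2).trans (le_max_left _ _)
    · have : |ρ| ≤ |R| := by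
        rw [abs_of_nonpos h2, abs_of_nonpos (h1.le.trans h2)]
        linarith
      exact this.trans (le_max_left _ _)
  rw [Real.norm_eq_abs, hB]
  calc |vortCirc (nsRescale (lam j) v) ρ z s| ≤ ‖curlCLM‖ * Kd / (-s) * |ρ| * |2 * Real.pi - 0| :=
        abs_vortCirc_zoom_le hlam hgrad hs ρ z j
    _ ≤ ‖curlCLM‖ * Kd / (-s) * max |R| 1 * |2 * Real.pi - 0| := by gcongr

/-- **`Γ_{zoom_j}(R,z,s) → 0`** under FLUX DECAY of `v` (`R ≥ 0`): `Γ_{zoom_j}(R,z,s) = Γ_v(λ_jR, λ_jz, λ_j²s)`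
(scale covariance), the data `(λ_jR, λ_jz, λ_j²s)` enter every apex window `𝒬(ρ)` for `j` large, and `Γ_v ≥ 0`
there (sign `ω₃ ≥ 0`). -/
theorem circ_zoom_tendsto_zero (hlam : ∀ j, 0 < lam j) (hlam0 : Tendsto lam atTop (𝓝 0))
    (hv : ∀ t < 0, ContDiff ℝ 1 (v t)) (hsign : SignE3 v) (hflux : FluxDecay v)
    {s : ℝ} (hs : s < 0) {R : ℝ} (hR : 0 ≤ R) (z : ℝ) :
    Tendsto (fun j => circ (nsRescale (lam j) v) R z s) atTop (𝓝 0) := by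
  -- scale covariance of the axis circulation (cf. `…Rescale.circ_nsRescale`)
  have hcov : ∀ j, circ (nsRescale (lam j) v) R z s = circ v (lam j * R) (lam j * z) ((lam j) ^ 2 * s) := by
    intro j
    unfold circ
    congr 1
    funext θ
    have hc : (lam j) • cylPt R θ z = cylPt (lam j * R) θ (lam j * z) := smul_cylPoint (lam j) R θ z
    rw [nsRescale_apply, hc, real_inner_smul_left]
    ring
  simp only [hcov]
  refine Metric.tendsto_atTop.2 fun κ hκ => ?_
  obtain ⟨ρ, hρ, hwin⟩ := hflux κ hκ
  have hev1 : ∀ᶠ j in atTop, (lam j) ^ 2 * (-s) < ρ ^ 2 := by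
    have h : Tendsto (fun j => (lam j) ^ 2 * (-s)) atTop (𝓝 (0 ^ 2 * (-s))) := (hlam0.pow 2).mul_const _
    rw [zero_pow two_ne_zero, zero_mul] at h
    exact h.eventually (gt_mem_nhds (pow_pos hρ 2))
  have hev2 : ∀ᶠ j in atTop, lam j * R < ρ := by
    have h : Tendsto (fun j => lam j * R) atTop (𝓝 (0 * R)) := hlam0.mul_const _
    rw [zero_mul] at h
    exact h.eventually (gt_mem_nhds hρ)
  have hev3 : ∀ᶠ j in atTop, |lam j * z| < ρ := by
    have h : Tendsto (fun j => |lam j * z|) atTop (𝓝 (|0 * z|)) := (hlam0.mul_const _).abs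
    rw [zero_mul, abs_zero] at h
    exact h.eventually (gt_mem_nhds hρ)
  obtain ⟨N, hN⟩ := eventually_atTop.1 (hev1.and (hev2.and hev3))
  refine ⟨N, fun j hj => ?_⟩
  obtain ⟨h1, h2, h3⟩ := hN j hj
  have hl : 0 < lam j := hlam j
  have hs' : (lam j) ^ 2 * s < 0 := mul_neg_of_pos_of_neg (pow_pos hl 2) hs
  have h0 : 0 ≤ circ v (lam j * R) (lam j * z) ((lam j) ^ 2 * s) :=
    circ_nonneg v (hv _ hs') hsign hs' (mul_nonneg hl.le hR) _
  rw [Real.dist_eq, sub_zero, abs_of_nonneg h0]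
  rcases hR.eq_or_lt with hR0 | hRpos
  · rw [← hR0, mul_zero, AveragedConeLiouville.CircMonotone.circ_zero]
    exact hκ
  · exact hwin _ _ _ (by nlinarith) hs' (mul_pos hl hRpos) h2 h3

/-- **The zoom limit has vanishing axis circulation**: `Γ_{v₁}(R,z,s) = 0` for all `s < 0`, `R ≥ 0`, `z`. -/
theorem circ_zoomLimit_eq_zero (hlam : ∀ j, 0 < lam j) (hlam0 : Tendsto lam atTop (𝓝 0))
    (hzoom : ∀ s < 0, ∀ y, Tendsto (fun j => (lam j) ^ 2 • curl (v ((lam j) ^ 2 * s)) ((lam j) • y)) atTop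
      (𝓝 (curl (v₁ s) y)))
    (hv : ∀ t < 0, ContDiff ℝ 1 (v t)) (hv₁ : ∀ t < 0, ContDiff ℝ 1 (v₁ t))
    (hgrad : ∀ t < 0, ∀ y, ‖fderiv ℝ (v t) y‖ ≤ Kd / (-t))
    (hsign : SignE3 v) (hflux : FluxDecay v)
    {s : ℝ} (hs : s < 0) {R : ℝ} (hR : 0 ≤ R) (z : ℝ) : circ v₁ R z s = 0 :=
  tendsto_nhds_unique (circ_zoom_tendsto hlam hzoom hv hv₁ hgrad hs R z)
    (circ_zoom_tendsto_zero hlam hlam0 hv hsign hflux hs hR z)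

/-! ### the registered stub (6) -/

/-- **Stub (6) `stub_regularOfFluxDecay : RegularOfFluxDecay` of `Cruxes/AveragedConeLiouville/Lines/lrt_shell.lean`**
(the type of this declaration is literally `…AxisTwistDoorAveragedConeLiouvilleDefs.RegularOfFluxDecay`).  REGULAR
APEX FROM FLUX DECAY, by a second zoom: were the apex singular, the zoom limit `v₁` (stub (0)'s `profileZoomFrame`,
a class profile backward singular at `0`) would inherit `ω₃ ≥ 0` and the slack-free cone and would have `Γ ≡ 0`
(`circ_zoomLimit_eq_zero`), so by the flat-flux rigidity
(`…FlatFlux.not_backwardSingular_of_signE3_globalCone_circ_eq_zero`) it would be backward regular at `0` —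
contradiction.  The antecedents `StubCircleSwirl`, `CircleToolkit`, `ShellFact` are not used.
[cite: LeiRenTian2025, §4 p. 11–12; AlbrittonBarker2019, Prop. 2.3] -/
theorem regularOfFluxDecay : AxisTwistDoorAveragedConeLiouvilleDefs.RegularOfFluxDecay := by
  intro _ _ _ C v π H hcl hsign hcone hflux hsing
  have hC : 0 ≤ C := by
    have h := hcl.decay (-1) (by norm_num) 0
    rw [neg_neg, Real.sqrt_one, div_one] at h
    exact (norm_nonneg _).trans h
  obtain ⟨πn, lam, w, v₁, ϖ, H', Ks, r₁, -, hlam, hlam0, hball1, hr₁, hr₁1, hKs, hL3, -, hae, hP, hsing₁⟩ :=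
    profileZoomFrame hC hcl.decay hcl.suitable hcl.weakGrad hcl.typeI hsing
  -- pointwise convergence of the zoomed vorticities (stub (0), part 2a)
  have hzoom : ∀ s < 0, ∀ y, Tendsto (fun j => (lam j) ^ 2 • curl (v ((lam j) ^ 2 * s)) ((lam j) • y)) atTop
      (𝓝 (curl (v₁ s) y)) :=
    fun s hs y => profileZoom_curl_tendsto hcl.decay hcl.cont hball1 hlam hlam0 hr₁ hr₁1 hKs hL3 hae hP s hs y
  obtain ⟨hrate₁, hcont₁, hmild₁, hdiv₁⟩ := hP
  -- regularity of slices and the class gradient rate of `v`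
  have hv : ∀ t < 0, ContDiff ℝ 1 (v t) := fun t ht => contDiff_one_slice hcl.decay hcl.cont hcl.mild ht
  have hv₁ : ∀ t < 0, ContDiff ℝ 1 (v₁ t) := fun t ht => contDiff_one_slice hrate₁ hcont₁ hmild₁ ht
  have hcurl : ∀ t < 0, Continuous (curl (v t)) := fun t ht => continuous_curl (hv t ht)
  obtain ⟨Kd, -, hgrad⟩ := exists_fderiv_rate_of_class' hcl.decay hcl.cont hcl.mild
  -- the sign and the cone pass to the limit (stub (0), parts 2a/2b with zero slack)
  have hsign₁ : SignE3 v₁ := fun s hs y => inner_curl_nonneg_of_profileZoom hsign hzoom hlam s hs y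
  obtain ⟨K, hK, hKc⟩ := hcone
  have hcone₁ : GlobalCone v₁ :=
    ⟨K, hK, fun s hs r hr z => globalCone_of_profileZoom hlam hlam0 hzoom hcurl hgrad (K := K) (M := 0)
      (fun s' _ hs' r' hr' _ z' _ => by rw [zero_mul, add_zero]; exact hKc s' hs' r' hr' z') s hs r hr z⟩
  -- the axis circulation of the limit vanishes
  have hcirc : ∀ r ∈ Ioo (0 : ℝ) 1, ∀ z ∈ Ioo (-1 : ℝ) 1, circ v₁ r z (-1) = 0 :=
    fun r hr z _ => circ_zoomLimit_eq_zero hlam hlam0 hzoom hv hv₁ hgrad hsign hflux (by norm_num) hr.1.le z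
  exact AveragedConeLiouville.FlatFlux.not_backwardSingular_of_signE3_globalCone_circ_eq_zero hrate₁ hcont₁ hmild₁
    hdiv₁ hsign₁ hcone₁ (by norm_num : (-1 : ℝ) < 0) one_pos hcirc hsing₁

/-- **Stub credit by name**: the registered stub `stub_regularOfFluxDecay : RegularOfFluxDecay` under the skeleton's
own identifier. -/
theorem stub_regularOfFluxDecay : AxisTwistDoorAveragedConeLiouvilleDefs.RegularOfFluxDecay := regularOfFluxDecay

end Summit.NavierStokesRegularity.NavierStokesRegularity.Theorems.AveragedConeLiouvilleProfileZoom

end
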